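import Summits.Ventures.PercRepro.Night2LocalD2R14SixZeroG

/-!
# PercRepro — the six-element columns of R1₄ without a far preimage, part H: the spread part at one coloop
(night-2, gen 16)

With `z` the only coloop of `S` besides `y` (`|S| = 6`), the spread part is at most
`(4/25 + 8/175 + (4/175)·p₅)/(|G ∖ S| + 1)` where `p₅` is the number of pair preimages with `|G ∖ cl B| ≥ 5`
(`r14Spread_le_of_one_coloop`): at most four bases spread, each face at `z` costs `≤ 2/175`, and the faces `S ∖ {x, z'}`
with `z' ≠ z` are pair preimages, each counted at most twice and costing `≤ 2/175` only when `|G ∖ cl| ≥ 5`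
(proofs/NIGHT-2-k1.md §7.4, the linear accounting).
-/

namespace PercRepro.Shadow

open Finset PerFlat ThmH

variable {α : Type*} [DecidableEq α] {M : Matroid α} [M.Finite]

open scoped Classical in
/-- **The spread part at one coloop.** -/
theorem r14Spread_le_of_one_coloop {G : Finset α} (hG : G ∈ flatsQ M (4 + 1)) {y : α} (hyG : y ∈ G)
    (hyc : y ∉ clF M (G.erase y)) (hP : ∀ z ∈ G.erase y, 4 ≤ rkN M ((G.erase y).erase z)) {S : Finset α}
    (hS : S ∈ shadowAt M (4 + 2) 4 (Uq M (4 + 2) 4) G) (h6 : S.card = 6) {z : α} (hzS : z ∈ S) (hzy : z ≠ y)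
    (hz : z ∉ clF M (S.erase z)) (hone : ∀ z' ∈ S, z' ≠ y → z' ∉ clF M (S.erase z') → z' = z) :
    r14Spread M G S ≤ (4 / 25 + 8 / 175 + (4 / 175) *
      (((pairPre M 4 G S).filter (fun B => 5 ≤ (G \ clF M B).card)).card : ℚ)) / (((G \ S).card : ℚ) + 1) := by
  have hyS : y ∈ S := mem_of_mem_shadowAt_of_coloop (by rw [rkN_erase_eq_of_coloop hG hyG hyc]) hS
  set 𝓑 := ((membersIn M (Uq M (4 + 2) 4) G).filter (fun B => (G \ clF M B).card = 1 ∧ ¬ 5 ≤ B.card)).filter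
    (fun B => ∃ x ∈ S, S = insert x (B ∪ (G \ clF M B))) with h𝓑def
  set fW : Finset α → α → ℚ := fun B z' =>
    (if (B.erase z') ∪ (G \ clF M B) ∈ membersIn M (Uq M (4 + 2) 4) G then
      max 0 (r14Cov M G ((B.erase z') ∪ (G \ clF M B)) - 4 / 25) else 0) with hfWdef
  have hfW0 : ∀ B z', 0 ≤ fW B z' := by
    intro B z'
    rw [hfWdef]
    show (0 : ℚ) ≤ (if (B.erase z') ∪ (G \ clF M B) ∈ membersIn M (Uq M (4 + 2) 4) G then
      max 0 (r14Cov M G ((B.erase z') ∪ (G \ clF M B)) - 4 / 25) else 0)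
    split_ifs
    · exact le_max_left _ _
    · exact le_refl _
  have hfWle : ∀ B z', fW B z' ≤ 2 / 175 := by
    intro B z'
    rw [hfWdef]
    show (if (B.erase z') ∪ (G \ clF M B) ∈ membersIn M (Uq M (4 + 2) 4) G then
      max 0 (r14Cov M G ((B.erase z') ∪ (G \ clF M B)) - 4 / 25) else 0) ≤ 2 / 175
    split_ifs
    · exact faceW_le _ _
    · norm_num
  have hq1 : (0 : ℚ) < ((G \ S).card : ℚ) + 1 := by positivity
  have hF := r14Spread_le_six' hG hyG hyc hP hS h6
  rw [← h𝓑def] at hF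
  have h𝓑4 := card_spreading_le_four hG hyG hyc hP hS h6 hzS hzy hz
  rw [← h𝓑def] at h𝓑4
  -- the facts about a spreading basis
  have hbasis : ∀ B ∈ 𝓑, ∃ x ∈ S, x ≠ y ∧ x ≠ z ∧ B = (S.erase y).erase x ∧ G \ clF M B = {y} ∧
      B ∈ membersIn M (Uq M (4 + 2) 4) G := by
    intro B hB
    rw [h𝓑def, Finset.mem_filter, Finset.mem_filter] at hB
    obtain ⟨⟨hBm, hm1, hB5⟩, hex⟩ := hB
    obtain ⟨x, hx, hSx⟩ := exists_mem_clF_sdiff_of_spreading hG hyG hyc hP hS h6 hBm hm1 hB5 hex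
    obtain ⟨hGy, hyB, hxB, hxy, hB4, hSx'⟩ := basis_facts_of_six hG hyG hyc hP h6 hBm hm1 hx hSx
    have hxS : x ∈ S := by rw [hSx']; exact Finset.mem_insert_self _ _
    have hBeq : B = (S.erase y).erase x := by
      ext e
      rw [Finset.mem_erase, Finset.mem_erase, hSx', Finset.mem_insert, Finset.mem_union, Finset.mem_singleton]
      constructor
      · intro he
        exact ⟨fun h => hxB (h ▸ he), fun h => hyB (h ▸ he), Or.inr (Or.inl he)⟩
      · rintro ⟨hex, hey, h⟩
        rcases h with h | h | h
        · exact absurd h hex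
        · exact h
        · exact absurd h hey
    refine ⟨x, hxS, hxy, ?_, hBeq, hGy, hBm⟩
    intro hxz
    subst hxz
    exact notMem_membersIn_of_coloop_basis hG hyG hyc hS hzS hzy hz (hBeq ▸ hBm)
  -- split the inner sums at `z' = z`
  have hsplit : ∀ B ∈ 𝓑, ∑ z' ∈ B, fW B z' ≤ 2 / 175 + ∑ z' ∈ B.erase z, fW B z' := by
    intro B _
    by_cases hzB : z ∈ B
    · rw [← Finset.add_sum_erase B _ hzB]
      linarith [hfWle B z]
    · rw [Finset.erase_eq_of_notMem hzB]
      linarith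
  -- the double sum over `(B, z')`, `z' ≠ z`
  set P := 𝓑.sigma (fun B => B.erase z) with hPdef
  have hP1 : ∑ B ∈ 𝓑, ∑ z' ∈ B.erase z, fW B z' = ∑ p ∈ P, fW p.1 p.2 := by
    rw [hPdef, Finset.sum_sigma]
  have hP2 : ∑ p ∈ P, fW p.1 p.2 ≤ ((P.filter (fun p => 0 < fW p.1 p.2)).card : ℚ) * (2 / 175) := by
    rw [← nsmul_eq_mul, ← Finset.sum_const, ← Finset.sum_filter_add_sum_filter_not P (fun p => 0 < fW p.1 p.2)]
    have h0 : ∑ p ∈ P.filter (fun p => ¬ 0 < fW p.1 p.2), fW p.1 p.2 = 0 := by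
      apply Finset.sum_eq_zero
      intro p hp
      rw [Finset.mem_filter] at hp
      have := hfW0 p.1 p.2
      linarith [hp.2]
    rw [h0, add_zero]
    exact Finset.sum_le_sum (fun p _ => hfWle p.1 p.2)
  -- the positive terms inject (≤ 2-to-1) into the pair preimages of `|G ∖ cl| ≥ 5`
  set face : (Σ _ : Finset α, α) → Finset α := fun p => (p.1.erase p.2) ∪ (G \ clF M p.1) with hfacedef
  have hpos : ∀ p ∈ P.filter (fun p => 0 < fW p.1 p.2),
      face p ∈ (pairPre M 4 G S).filter (fun B => 5 ≤ (G \ clF M B).card) := by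
    intro p hp
    rw [Finset.mem_filter, hPdef, Finset.mem_sigma] at hp
    obtain ⟨⟨hB, hz'⟩, hposw⟩ := hp
    obtain ⟨x, hxS, hxy, hxz, hBeq, hGy, hBm⟩ := hbasis p.1 hB
    rw [Finset.mem_erase] at hz'
    have hmem : (p.1.erase p.2) ∪ (G \ clF M p.1) ∈ membersIn M (Uq M (4 + 2) 4) G := by
      by_contra h
      have : fW p.1 p.2 = 0 := by
        rw [hfWdef]
        show (if (p.1.erase p.2) ∪ (G \ clF M p.1) ∈ membersIn M (Uq M (4 + 2) 4) G then
          max 0 (r14Cov M G ((p.1.erase p.2) ∪ (G \ clF M p.1)) - 4 / 25) else 0) = 0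
        rw [if_neg h]
      linarith
    have h5 : 5 ≤ (G \ clF M ((p.1.erase p.2) ∪ (G \ clF M p.1))).card := by
      by_contra h
      push Not at h
      have : fW p.1 p.2 = 0 := by
        rw [hfWdef]
        show (if (p.1.erase p.2) ∪ (G \ clF M p.1) ∈ membersIn M (Uq M (4 + 2) 4) G then
          max 0 (r14Cov M G ((p.1.erase p.2) ∪ (G \ clF M p.1)) - 4 / 25) else 0) = 0
        rw [if_pos hmem, faceW_eq_zero_of_le_four (by omega)]
      linarith
    rw [Finset.mem_filter]
    exact ⟨face_mem_pairPre_of_one_coloop hG hyG hyc hS hone hxS hxy hxz hBeq hGy hz'.2 hz'.1 hmem, h5⟩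
  have hfib : ∀ F ∈ (pairPre M 4 G S).filter (fun B => 5 ≤ (G \ clF M B).card),
      ((P.filter (fun p => 0 < fW p.1 p.2)).filter (fun p => face p = F)).card ≤ 2 := by
    intro F hF
    -- `(B, z') ↦ z'` is injective into `S ∖ F` (two elements)
    have hmaps : ∀ p ∈ (P.filter (fun p => 0 < fW p.1 p.2)).filter (fun p => face p = F), p.2 ∈ S \ F := by
      intro p hp
      rw [Finset.mem_filter, Finset.mem_filter, hPdef, Finset.mem_sigma] at hp
      obtain ⟨⟨⟨hB, hz'⟩, -⟩, hpF⟩ := hp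
      obtain ⟨x, hxS, hxy, hxz, hBeq, hGy, hBm⟩ := hbasis p.1 hB
      rw [Finset.mem_erase] at hz'
      have hz'S : p.2 ∈ S := by
        have := hz'.2
        rw [hBeq, Finset.mem_erase, Finset.mem_erase] at this
        exact this.2.2
      rw [Finset.mem_sdiff]
      refine ⟨hz'S, ?_⟩
      rw [← hpF, hfacedef]
      show p.2 ∉ (p.1.erase p.2) ∪ (G \ clF M p.1)
      rw [Finset.mem_union, Finset.mem_erase, hGy, Finset.mem_singleton, not_or]
      refine ⟨fun h => h.1 rfl, ?_⟩
      intro h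
      have := hz'.2
      rw [hBeq, h, Finset.mem_erase, Finset.mem_erase] at this
      exact this.2.1 rfl
    have hinj : Set.InjOn (fun p : (Σ _ : Finset α, α) => p.2)
        (((P.filter (fun p => 0 < fW p.1 p.2)).filter (fun p => face p = F)) : Set (Σ _ : Finset α, α)) := by
      intro p hp p' hp' h
      rw [Finset.mem_coe, Finset.mem_filter, Finset.mem_filter, hPdef, Finset.mem_sigma] at hp hp'
      obtain ⟨⟨⟨hB, hz'⟩, -⟩, hpF⟩ := hp
      obtain ⟨⟨⟨hB', hz''⟩, -⟩, hpF'⟩ := hp'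
      rw [Finset.mem_erase] at hz' hz''
      obtain ⟨x, hxS, hxy, hxz, hBeq, hGy, hBm⟩ := hbasis p.1 hB
      obtain ⟨x', hxS', hxy', hxz', hBeq', hGy', hBm'⟩ := hbasis p'.1 hB'
      have h2 : p.2 = p'.2 := h
      -- the faces agree: `S ∖ {x, p.2} = S ∖ {x', p.2}`, so `x = x'`
      have hface : (p.1.erase p.2) ∪ (G \ clF M p.1) = (p'.1.erase p'.2) ∪ (G \ clF M p'.1) := hpF.trans hpF'.symm
      rw [hGy, hGy', hBeq, hBeq', ← h2] at hface
      have hxx : x = x' := by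
        by_contra hne
        -- `x' ∈ LHS` (`x' ≠ x`, `x' ≠ y`, `x' ≠ p.2`?) — `x' ∈ S`, `x' ≠ x`, `x' ≠ y`; if `x' = p.2` swap roles
        have hz'x : p.2 ≠ x := by
          have := hz'.2
          rw [hBeq, Finset.mem_erase] at this
          exact this.1
        have hz'x' : p.2 ≠ x' := by
          have := hz''.2
          rw [hBeq', Finset.mem_erase, ← h2] at this
          exact this.1
        have hx'L : x' ∈ (((S.erase y).erase x).erase p.2) ∪ {y} := by
          rw [Finset.mem_union, Finset.mem_erase, Finset.mem_erase, Finset.mem_erase]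
          exact Or.inl ⟨hz'x'.symm, fun h => hne h.symm, hxy', hxS'⟩
        rw [hface, Finset.mem_union, Finset.mem_erase, Finset.mem_erase, Finset.mem_erase, Finset.mem_singleton] at hx'L
        rcases hx'L with ⟨-, h, -⟩ | h
        · exact h rfl
        · exact hxy' h
      rw [Sigma.ext_iff]
      refine ⟨?_, ?_⟩
      · rw [hBeq, hBeq', hxx]
      · exact heq_of_eq h2
    have h1 := Finset.card_le_card_of_injOn (fun p : (Σ _ : Finset α, α) => p.2) hmaps hinj
    -- `|S ∖ F| = 2`
    rw [Finset.mem_filter] at hF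
    have h2 := card_sdiff_of_mem_pairPre hF.1
    omega
  have hcount := Finset.card_le_mul_card_image_of_maps_to (f := face) hpos 2 hfib
  -- assemble
  have hsum : ∑ B ∈ 𝓑, (1 / 25 + ∑ z' ∈ B, fW B z') ≤
      4 / 25 + 8 / 175 + (4 / 175) * (((pairPre M 4 G S).filter (fun B => 5 ≤ (G \ clF M B).card)).card : ℚ) := by
    calc ∑ B ∈ 𝓑, (1 / 25 + ∑ z' ∈ B, fW B z')
        ≤ ∑ B ∈ 𝓑, (1 / 25 + (2 / 175 + ∑ z' ∈ B.erase z, fW B z')) := by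
          apply Finset.sum_le_sum
          intro B hB
          linarith [hsplit B hB]
      _ = (𝓑.card : ℚ) * (1 / 25 + 2 / 175) + ∑ p ∈ P, fW p.1 p.2 := by
          rw [Finset.sum_add_distrib, Finset.sum_add_distrib, Finset.sum_const, Finset.sum_const, nsmul_eq_mul,
            nsmul_eq_mul, hP1]
          ring
      _ ≤ 4 * (1 / 25 + 2 / 175) + ((P.filter (fun p => 0 < fW p.1 p.2)).card : ℚ) * (2 / 175) := by
          have h𝓑q : (𝓑.card : ℚ) ≤ 4 := by exact_mod_cast h𝓑4
          nlinarith
      _ ≤ 4 / 25 + 8 / 175 + (4 / 175) * (((pairPre M 4 G S).filter (fun B => 5 ≤ (G \ clF M B).card)).card : ℚ) := by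
          have hc : ((P.filter (fun p => 0 < fW p.1 p.2)).card : ℚ) ≤
              2 * (((pairPre M 4 G S).filter (fun B => 5 ≤ (G \ clF M B).card)).card : ℚ) := by
            have : (P.filter (fun p => 0 < fW p.1 p.2)).card ≤
                2 * ((pairPre M 4 G S).filter (fun B => 5 ≤ (G \ clF M B).card)).card := by omega
            exact_mod_cast this
          nlinarith
  calc r14Spread M G S ≤ ∑ B ∈ 𝓑, (1 / 25 + ∑ z' ∈ B, fW B z') / (((G \ S).card : ℚ) + 1) := hF
    _ = (∑ B ∈ 𝓑, (1 / 25 + ∑ z' ∈ B, fW B z')) / (((G \ S).card : ℚ) + 1) := by rw [Finset.sum_div]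
    _ ≤ _ := div_le_div_of_nonneg_right hsum hq1.le

end PercRepro.Shadow
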